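import Literature.IUT.HodgeArakelov.EtaleThetaDataOfSettingInversionAb
import Literature.IUT.HodgeArakelov.EtaleThetaDataOfSettingInversionZ
import Literature.AnabelianGeometry.EtaleTheta.Discharge.Sec1AutPreservesDeltaTemp

/-!
# [IUTchII] Prop 2.2 (ii)′ at the MODEL: the closing theorems with (R1b′)-hΔ and (R1c)-hZ DISCHARGED
# (GAP row G-w4d010-2, dispositions D-G-w4d010-2g and -2h)

S. Mochizuki, *Inter-universal Teichmüller theory II*, kurims manuscript (Dec. 2020) §2, Prop. 2.2 (ii) p. 66, Rmk. 1.4.1 (ii)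
p. 28, Rmk. 2.1.1 (i) p. 65 (claim key `Mochizuki2012`, DISPUTED, D-0012); [EtTh] §2 p. 36, Prop. 2.2 (i) p. 37, proof of
Thm. 1.6 p. 24; [AbsAnab] Lem. 1.3.8 (FACT-LIST F-0007 `FundamentalExtension.PreservesGeom`).

PROOF-ONLY companion (cell abc-iut, wave-4 seat abc-iut-w4-d014; NO definitions, NO `Prop`-valued facts; node
**IUTchII:Prop2.2(ii)**), pure composition BY NAME of: abc-iut-w5-d072's `prop22_ii'_model_of_inversion_of_hinv` and
`toZ_inversion_generator_of_inversion` (p420219: hZ ⟸ (R1e′)+(H1)), abc-iut-w4-d014's `prop22_ii'_model_of_thetaKummer_of_aut`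
(p419591: hβ ⟸ (R1e′)) and `Sec1AutPreservesDeltaTemp` (hΔ ⟸ «ι over G_K» resp. ⟸ F-0007), over abc-iut-w4-d010's END-TO-END
assembly (p417690).
* `prop22_ii'_model_of_inversion_of_hinv_over` — d072's class-level closer with `hΔ` discharged for `ι` OVER `G_K` (up to an inner
  automorphism of the Galois side: `aug (ι x) = a·aug(x)·a⁻¹`);
* `prop22_ii'_model_of_thetaKummer_of_aut_over` — THE END-TO-END closer: `Prop22_ii' Dec` at the model from the ι-DATUM
  «`ι ∈ Aut_top(Π^tp_X)` over `G_K` up to `Inn`, with `ι(Π^tp_X̲̲) = Π^tp_X̲̲` (R1a), `ι² = conj δ` on `Π^tp_X̲̲`, `ι̂ ≡ −1` on `Δ_X^ab` (R1e′)»,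
  the root-topology input `hq : IsQuotientMap toTheta`, and abc-iut-w5-d125's FUNCTION-level [EtTh] Prop. 1.4 package — `hΔ`, `hZ`,
  `hβ` are ALL theorems now;
* `prop22_ii'_model_of_thetaKummer_of_aut_of_preservesGeom` — the same with `hΔ` BY NAME from F-0007 ([AbsAnab] Lem. 1.3.8) at a
  fundamental extension `(E, e)` modelling `Π_X ↠ G_K`, for an ARBITRARY topological automorphism `ι` (no «over `G_K`»).
Honest framing: every input about `ι`, `hq`, and every [EtTh] Prop. 1.4 statement stays a hypothesis; F-0007 enters as a named
hypothesis at an instance; nothing here bears on [IUTchIII] Cor. 3.12. [claim: Mochizuki2012, status: disputed] typed ≠ proved.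
-/

namespace Literature.IUT.HodgeArakelov

open Literature.AnabelianGeometry.EtaleTheta (ContH1 ThetaSetting RootSystem cyclotome)
open Literature.AnabelianGeometry.EtaleTheta Literature.AnabelianGeometry.AbsoluteAnabelian
open Literature.AnabelianGeometry.SemiGraphs (GQp)
open EtaleThetaDataOfSetting CohomologySystemOfContH1 Topology
open scoped commutatorElement

noncomputable section

namespace EtaleThetaDataOfSetting

variable {p : ℕ} [Fact p.Prime] {D : Literature.AnabelianGeometry.EtaleTheta.ThetaSetting p}
  {E : D.EtaleThetaData} {l : ℕ} (C : E.DoubleUnderline l)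

section Inversion

variable (ι : D.PiTemp ≃ₜ* D.PiTemp) (hι : C.Huu.map ι.toMulEquiv.toMonoidHom = C.Huu)
  (hinv : ∀ g ∈ D.toTemperedCurve.DeltaHat, D.toTemperedCurve.completionAut ι g * g ∈
    (⁅D.toTemperedCurve.DeltaHat, D.toTemperedCurve.DeltaHat⁆).topologicalClosure)

include hinv in
/-- **IUTchII:Prop2.2(ii)′ at the model, class-level inputs, for `ι` OVER `G_K`** (kurims p. 66): abc-iut-w5-d072's
`prop22_ii'_model_of_inversion_of_hinv` (p420219) with the binder `hΔ : ι(Δ^tp_X) = Δ^tp_X` DISCHARGED by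
`ThetaSetting.map_deltaTemp_eq_of_aug_conj` from «`aug (ι x) = a·aug(x)·a⁻¹`» ([IUTchII] Rmk. 1.4.1 (ii): `ι` over `G_k`).
[claim: Mochizuki2012, status: disputed] (IUTchII §2 Prop 2.2 (ii), kurims pp.65-67) -/
theorem prop22_ii'_model_of_inversion_of_hinv_over [hN : (PiYdd C).Normal] (hC : D.Compat) (hS : D.Sec2Hyps)
    (hchar : PiYddCharacteristic C) (S : BadPlaceSetting.{0}) (eS : (Pi C) ≃ₜ* S.PiX) (hl : S.l = l)
    {T : TemperedCoverings S (Pi C)}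
    (Dec : SubgraphDecomposition S T (etaleThetaDataOfSetting' C hC hS hchar S.toThetaSetting eS hl))
    (a : GQp p) (haug : ∀ x : D.PiTemp, D.aug (ι x) = a * D.aug x * a⁻¹) (hq : IsQuotientMap D.toTheta)
    (γ ε : Pi C) (hγ : C.toLZ γ = Multiplicative.ofAdd 1) (hε₁ : (ε : D.PiTemp) ∈ D.GtpY)
    (hε₂ : (ε : D.PiTemp) ∉ D.GtpYdd)
    (hsign : ∃ κ : ContH1 (phi C) (D.lDeltaTheta l) (PiYdd C ⊓ ⊤), κ ^ 2 = 1 ∧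
      ContH1.conj (phi C) (D.lDeltaTheta l) ε (rootLiftClass C) = rootLiftClass C * κ)
    (hroot : ∃ τ₀ : Pi C, (τ₀ : D.PiTemp) ∈ D.GtpY ∧
      inversionTransport C ι hι (D.thetaCompanionOfAut ι (D.map_deltaTemp_eq_of_aug_conj ι a haug) hq) hchar
          (rootLiftClass C) =
        ContH1.conj (phi C) (D.lDeltaTheta l) τ₀ (rootLiftClass C))
    (hfree : ∀ m n : ℤ, IsOfFinAddOrder
      ((h1Top C).symm (Additive.ofMul (ContH1.conj (phi C) (D.lDeltaTheta l) (γ ^ m) (rootLiftClass C))) -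
        (h1Top C).symm (Additive.ofMul (ContH1.conj (phi C) (D.lDeltaTheta l) (γ ^ n) (rootLiftClass C)))) →
      m = n) :
    Prop22_ii' Dec :=
  prop22_ii'_model_of_inversion_of_hinv C ι hι hinv hC hS hchar S eS hl Dec (D.map_deltaTemp_eq_of_aug_conj ι a haug)
    hq γ ε hγ hε₁ hε₂ hsign hroot hfree

include hι hinv in
/-- **IUTchII:Prop2.2(ii)′ at the model — END-TO-END from the ι-DATUM over `G_K`** (kurims p. 66): `Prop22_ii' Dec` for every
Prop. 2.2 (i) datum `Dec` at `D := etaleThetaDataOfSetting'` (abc-iut-L6-t1), GIVEN: (model) `C`, `hC`, `hS`, (H1) `hchar`, `S`, `eS`,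
`hl`; (the inversion) a topological automorphism `ι` of `Π^tp_X` OVER `G_K` up to `Inn` (`haug`) with `ι(Π^tp_X̲̲) = Π^tp_X̲̲` (`hι`,
(R1a) = [EtTh] Def. 2.5 (i)(b)), `ι² = conj δ` on `Π^tp_X̲̲` (`hιι`), `ι̂ ≡ −1` on `Δ_X^ab` (`hinv`, (R1e′) = [EtTh] p. 36 «multiplication
by `−1` on the underlying elliptic curve»); the root-topology input `hq`; a deck element `ε`; a `toLZ`-generator `γ`; and
abc-iut-w5-d125's FUNCTION-level [EtTh] Prop. 1.4 package on a `ThetaKummerInput`. The former binders `hΔ` (ι(Δ^tp_X) = Δ^tp_X),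
`hZ` (ι reverses `Z`, [IUTchII] Rmk. 2.1.1 (i)) and `hβ` (`ι^Θ ≡ +1` on `Δ̄_Θ`, [EtTh] Prop. 2.2 (i)) are THEOREMS
(`Sec1AutPreservesDeltaTemp`, p420219, p419214) and no longer appear. [claim: Mochizuki2012, status: disputed]
(IUTchII §2 Prop 2.2 (ii), kurims pp.65-67) -/
theorem prop22_ii'_model_of_thetaKummer_of_aut_over (a : GQp p) (haug : ∀ x : D.PiTemp, D.aug (ι x) = a * D.aug x * a⁻¹)
    (hq : IsQuotientMap D.toTheta)
    [hN : (PiYdd C).Normal] [hYN : D.GtpYdd.Normal] (hC : D.Compat) (hS : D.Sec2Hyps)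
    (hchar : PiYddCharacteristic C) (S : BadPlaceSetting.{0}) (eS : (Pi C) ≃ₜ* S.PiX) (hl : S.l = l)
    {T₀ : TemperedCoverings S (Pi C)}
    (Dec : SubgraphDecomposition S T₀ (etaleThetaDataOfSetting' C hC hS hchar S.toThetaSetting eS hl))
    (γ ε : Pi C) (hγ : C.toLZ γ = Multiplicative.ofAdd 1) (hε₁ : (ε : D.PiTemp) ∈ D.GtpY)
    (hε₂ : (ε : D.PiTemp) ∉ D.GtpYdd)
    (δ : Pi C) (hιι : ∀ x : Pi C, ι (ι (x : D.PiTemp)) = (δ : D.PiTemp) * (x : D.PiTemp) * (δ : D.PiTemp)⁻¹)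
    -- (R2)(R3) the FUNCTION-level [EtTh] Prop. 1.4 package on t12's `ThetaKummerInput`
    (T : D.ThetaKummerInput) (hη : E.etaDd = T.kummerTheta)
    (hdeck : ∀ e' : D.PiTemp, e' ∈ D.GtpY → e' ∉ D.GtpYdd → e' • T.theta = T.const (-1) * T.theta)
    (ιFn : T.Fn →* T.Fn)
    (hιFn : ∀ (g : Pi C) (f : T.Fn), ιFn ((g : D.PiTemp) • f) = ι (g : D.PiTemp) • ιFn f)
    (hΛ : ∀ ζ : cyclotome T.Fn, ContH1Aut.coeffMap D.DeltaTheta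
        (D.thetaCompanionOfAut ι (D.map_deltaTemp_eq_of_aug_conj ι a haug) hq).thetaIso
        (thetaCompanion_mem_deltaTheta ι (D.thetaCompanionOfAut ι (D.map_deltaTemp_eq_of_aug_conj ι a haug) hq))
        (T.coeff.hom ζ) = T.coeff.hom (cyclotome.map ιFn ζ))
    (hιθ : ιFn T.theta = T.const (-1) * T.theta)
    {udd : T.Fn} (hu : udd ∈ MulAction.fixedPoints D.GtpYdd T.Fn) (xpow : ∀ m : ℤ, RootSystem (udd ^ m))
    (e : ℤ) (he : e ≠ 0)
    (hpow : ∀ k : ℤ, ∃ ck : (↥D.Kdd)ˣ, ((γ : D.PiTemp) ^ k) • T.theta = T.const ck * udd ^ (e * k) * T.theta)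
    (hΛbij : Function.Bijective T.coeff.hom)
    (ord : T.Fn →* Multiplicative ℚ) (hordc : ∀ ck, ord (T.const ck) = 1) (hordu : ord udd ≠ 1)
    {d : ℕ} (hd : 0 < d)
    (hint : ∀ f ∈ MulAction.fixedPoints ((PiYdd C ⊓ ⊤).map C.Huu.subtype) T.Fn,
      ∃ z : ℤ, Multiplicative.toAdd (ord f) = z / d) :
    Prop22_ii' Dec :=
  prop22_ii'_model_of_thetaKummer_of_aut C ι hι (D.map_deltaTemp_eq_of_aug_conj ι a haug) hq hC hS hchar S eS hl Dec γ ε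
    hγ hε₁ hε₂ (toZ_inversion_generator_of_inversion C ι hι hinv hS hchar γ hγ) δ hιι hinv T hη hdeck ιFn hιFn hΛ hιθ hu
    xpow e he hpow hΛbij ord hordc hordu hd hint

include hι hinv in
/-- **IUTchII:Prop2.2(ii)′ at the model — END-TO-END for an ARBITRARY topological automorphism `ι`, `hΔ` BY NAME from [AbsAnab]
Lem. 1.3.8** (FACT-LIST F-0007 `FundamentalExtension.PreservesGeom`, bound at a fundamental extension `(E, e)` modelling
`Π_X ↠ G_K`: `e : Π_E ⥲ Π_X`, `e(Δ_E) = Δ_X`, and the instance of the fact at `e ≫ ι̂ ≫ e⁻¹`); otherwise as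
`prop22_ii'_model_of_thetaKummer_of_aut_over`. [claim: Mochizuki2012, status: disputed] (IUTchII §2 Prop 2.2 (ii), kurims pp.65-67) -/
theorem prop22_ii'_model_of_thetaKummer_of_aut_of_preservesGeom (F : FundamentalExtension.{0})
    (eF : F.arith ≃ₜ* D.PiHat) (heF : F.geom.map eF.toMulEquiv.toMonoidHom = D.DeltaHat)
    (h138 : FundamentalExtension.PreservesGeom (F := F)
      (eF.trans ((D.toTemperedCurve.completionAut ι).trans eF.symm)))
    (hq : IsQuotientMap D.toTheta)
    [hN : (PiYdd C).Normal] [hYN : D.GtpYdd.Normal] (hC : D.Compat) (hS : D.Sec2Hyps)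
    (hchar : PiYddCharacteristic C) (S : BadPlaceSetting.{0}) (eS : (Pi C) ≃ₜ* S.PiX) (hl : S.l = l)
    {T₀ : TemperedCoverings S (Pi C)}
    (Dec : SubgraphDecomposition S T₀ (etaleThetaDataOfSetting' C hC hS hchar S.toThetaSetting eS hl))
    (γ ε : Pi C) (hγ : C.toLZ γ = Multiplicative.ofAdd 1) (hε₁ : (ε : D.PiTemp) ∈ D.GtpY)
    (hε₂ : (ε : D.PiTemp) ∉ D.GtpYdd)
    (δ : Pi C) (hιι : ∀ x : Pi C, ι (ι (x : D.PiTemp)) = (δ : D.PiTemp) * (x : D.PiTemp) * (δ : D.PiTemp)⁻¹)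
    (T : D.ThetaKummerInput) (hη : E.etaDd = T.kummerTheta)
    (hdeck : ∀ e' : D.PiTemp, e' ∈ D.GtpY → e' ∉ D.GtpYdd → e' • T.theta = T.const (-1) * T.theta)
    (ιFn : T.Fn →* T.Fn)
    (hιFn : ∀ (g : Pi C) (f : T.Fn), ιFn ((g : D.PiTemp) • f) = ι (g : D.PiTemp) • ιFn f)
    (hΛ : ∀ ζ : cyclotome T.Fn, ContH1Aut.coeffMap D.DeltaTheta
        (D.thetaCompanionOfAut ι (D.map_deltaTemp_eq_of_preservesGeom ι F eF heF h138) hq).thetaIso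
        (thetaCompanion_mem_deltaTheta ι
          (D.thetaCompanionOfAut ι (D.map_deltaTemp_eq_of_preservesGeom ι F eF heF h138) hq))
        (T.coeff.hom ζ) = T.coeff.hom (cyclotome.map ιFn ζ))
    (hιθ : ιFn T.theta = T.const (-1) * T.theta)
    {udd : T.Fn} (hu : udd ∈ MulAction.fixedPoints D.GtpYdd T.Fn) (xpow : ∀ m : ℤ, RootSystem (udd ^ m))
    (e : ℤ) (he : e ≠ 0)
    (hpow : ∀ k : ℤ, ∃ ck : (↥D.Kdd)ˣ, ((γ : D.PiTemp) ^ k) • T.theta = T.const ck * udd ^ (e * k) * T.theta)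
    (hΛbij : Function.Bijective T.coeff.hom)
    (ord : T.Fn →* Multiplicative ℚ) (hordc : ∀ ck, ord (T.const ck) = 1) (hordu : ord udd ≠ 1)
    {d : ℕ} (hd : 0 < d)
    (hint : ∀ f ∈ MulAction.fixedPoints ((PiYdd C ⊓ ⊤).map C.Huu.subtype) T.Fn,
      ∃ z : ℤ, Multiplicative.toAdd (ord f) = z / d) :
    Prop22_ii' Dec :=
  prop22_ii'_model_of_thetaKummer_of_aut C ι hι (D.map_deltaTemp_eq_of_preservesGeom ι F eF heF h138) hq hC hS hchar S eS
    hl Dec γ ε hγ hε₁ hε₂ (toZ_inversion_generator_of_inversion C ι hι hinv hS hchar γ hγ) δ hιι hinv T hη hdeck ιFn hιFn hΛ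
    hιθ hu xpow e he hpow hΛbij ord hordc hordu hd hint

end Inversion

end EtaleThetaDataOfSetting

end

end Literature.IUT.HodgeArakelov
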